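import Mathlib
import Summits.BirchSwinnertonDyer.BirchSwinnertonDyer.Theses.UniversalToricDescent

/-!
# Sketch (utd-idea g58) — crux idea `base-doubling-tau-signs` on `RationalSplitIMCInclusionAtThree` (stmt-24207)

First checkable Lean-typed steps of the idea card `Cruxes/RationalSplitIMCInclusionAtThree/Ideas/base-doubling-tau-signs.md`.
Everything here is PROVED (no `sorry`); nothing here proves the crux.

* §1 `semiconj_eigenline`, `semiconj_mem_eigenspace`, `comm_mem_eigenspace_self` — the linear-algebra shadow of the
  LOCAL LEMMA L1♭ of the card: a `σ`-semilinear operator `φ` commuting with a linear operator `g` (the inertia /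
  descent-datum action on `D_pst`) carries the `ζ`-eigenline of `g` to the `σ ζ`-eigenline. With `σ = id`
  (ramified inducing field, `F'₀ = ℚ₃`: the SCr rows) `φ` PRESERVES each isotypic line; with `σ ζ = ζ⁻¹ ≠ ζ`
  (unramified inducing field `ℚ₉`: the SCu rows, after splitting coefficients) `φ` SWAPS them — the source of the
  period-2 ("Kobayashi-type") versus no-alternation dichotomy of the card.
* §2 `mem_of_algebraMap_mem_map` — CURRENCY DESCENT: along an algebra `A → B` admitting an `A`-linear retraction,
  ideal membership descends (`algebraMap x ∈ I.map algebraMap → x ∈ I`).  §3 instantiates it on the wall's own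
  objects: membership of `3^k · L` in `(XAc.charIdeal …).map (PowerSeries.map toUnr)` may be CHECKED after any further
  scalar extension `UnrSeries 3 → B` with a retraction (e.g. `B = R₀[√±3]⟦T⟧`, the coefficient ring in which the
  `τ`-signed Coleman images of the card live on the SCr rows) — so the card's `F'`-rational bookkeeping costs the
  wall statement nothing.
-/

namespace Summit.BirchSwinnertonDyer.BirchSwinnertonDyer.Cruxes.RationalSplitIMCInclusionAtThree.BaseDoubling

section LocalShadow

variable {R M : Type*} [CommRing R] [AddCommGroup M] [Module R M] {σ : R →+* R}

/-- L1♭ shadow: a `σ`-semilinear `f` commuting with a linear `g` maps a `ζ`-eigenvector of `g` to a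
`σ ζ`-eigenvector. (In the card: `f = φ` on `D = D_cris^{F'}(V₃E)`, `g` = the action of a generator of the
inertia image, `ζ` a primitive `e`-th root of unity.) -/
theorem semiconj_eigenline (f : M →ₛₗ[σ] M) (g : M →ₗ[R] M) (hfg : ∀ x, f (g x) = g (f x))
    (ζ : R) (x : M) (hx : g x = ζ • x) : g (f x) = σ ζ • f x := by
  rw [← hfg, hx, LinearMap.map_smulₛₗ]

/-- Eigenspace form of `semiconj_eigenline`: `f` maps `eigenspace g ζ` into `eigenspace g (σ ζ)`. -/
theorem semiconj_mem_eigenspace (f : M →ₛₗ[σ] M) (g : M →ₗ[R] M) (hfg : ∀ x, f (g x) = g (f x))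
    (ζ : R) {x : M} (hx : x ∈ Module.End.eigenspace g ζ) : f x ∈ Module.End.eigenspace g (σ ζ) := by
  rw [Module.End.mem_eigenspace_iff] at hx ⊢
  exact semiconj_eigenline f g hfg ζ x hx

/-- The SCr case (`σ = id`, i.e. `F'₀ = ℚ₃`, `φ` linear): a commuting linear `f` PRESERVES every eigenspace of `g`
— no swap, hence no period-2 alternation of the Hodge line's `φ`-orbit. -/
theorem comm_mem_eigenspace_self (f g : M →ₗ[R] M) (hfg : ∀ x, f (g x) = g (f x))
    (ζ : R) {x : M} (hx : x ∈ Module.End.eigenspace g ζ) : f x ∈ Module.End.eigenspace g ζ := by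
  rw [Module.End.mem_eigenspace_iff] at hx ⊢
  rw [← hfg, hx, LinearMap.map_smul]

/-- The SCu case in one line: if `σ ζ ≠ ζ` then `f` moves a NONZERO `ζ`-eigenvector OUT of the `ζ`-eigenline
(eigenspaces for distinct eigenvalues meet in `0`), provided `f x ≠ 0`. -/
theorem semiconj_not_mem_eigenspace_of_ne (f : M →ₛₗ[σ] M) (g : M →ₗ[R] M) (hfg : ∀ x, f (g x) = g (f x))
    (ζ : R) {x : M} (hx : x ∈ Module.End.eigenspace g ζ) (hfx : f x ≠ 0)
    (hζ : Disjoint (Module.End.eigenspace g ζ) (Module.End.eigenspace g (σ ζ))) :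
    f x ∉ Module.End.eigenspace g ζ := by
  intro h
  have h' := semiconj_mem_eigenspace f g hfg ζ hx
  exact hfx (Submodule.disjoint_def.mp hζ _ h h')

end LocalShadow

section CurrencyDescent

variable {A B : Type*} [CommRing A] [CommRing B] [Algebra A B]

/-- Currency descent along a retraction: if `r : B →ₗ[A] A` splits `algebraMap A B`, then
`algebraMap A B x ∈ I.map (algebraMap A B)` already forces `x ∈ I`.  (Used with `A = R₀⟦T⟧ = UnrSeries 3`,
`B = R₀[√d]⟦T⟧`, `r` = the `1`-coordinate on the basis `{1, √d}`.) -/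
theorem mem_of_algebraMap_mem_map (r : B →ₗ[A] A) (hr : ∀ a : A, r (algebraMap A B a) = a)
    (I : Ideal A) (x : A) (hx : algebraMap A B x ∈ I.map (algebraMap A B)) : x ∈ I := by
  have hx' : algebraMap A B x ∈ I • (⊤ : Submodule A B) := by
    rw [Ideal.smul_top_eq_map]; exact hx
  have h1 : r (algebraMap A B x) ∈ (I • (⊤ : Submodule A B)).map r := Submodule.mem_map_of_mem hx'
  rw [Submodule.map_smul'', hr] at h1
  have h2 : I • (Submodule.map r ⊤ : Submodule A A) ≤ I • ⊤ := Submodule.smul_mono le_rfl le_top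
  have h3 : x ∈ I • (⊤ : Submodule A A) := h2 h1
  simpa [Ideal.smul_eq_mul, Ideal.mul_top] using h3

end CurrencyDescent

section WallInstance

open Literature.NumberTheory.EllipticCurves

/-- §3. The wall's membership conclusion is insensitive to a further split scalar extension of `UnrSeries 3`:
for ANY `UnrSeries 3`-algebra `B` with a linear retraction, membership of `3^k · L` in the extended characteristic
ideal over `B` gives the membership `RationalSplitIMCInclusionAtThree` asks for.  Pure bookkeeping
(`mem_of_algebraMap_mem_map`); it is what lets the card compute with `R₀[√±3]`-coefficients on the SCr rows. -/
theorem wall_membership_descends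
    (W : WeierstrassCurve ℚ) (K : Type) [Field K] [NumberField K]
    (κ : ZpExtension K 3) (γ : Field.absoluteGaloisGroup K) [Fact (κ.IsTopGenerator γ)]
    (𝔭' : IsDedekindDomain.HeightOneSpectrum (NumberField.RingOfIntegers K))
    (B : Type*) [CommRing B] [Algebra (UnrSeries 3) B]
    (r : B →ₗ[UnrSeries 3] UnrSeries 3) (hr : ∀ a, r (algebraMap (UnrSeries 3) B a) = a)
    (L : UnrSeries 3) (k : ℕ)
    (h : algebraMap (UnrSeries 3) B (((3 : ℕ) : UnrSeries 3) ^ k * L) ∈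
      (((Summit.BirchSwinnertonDyer.Rank1Residual.X11b.AcSelmer.XAc.charIdeal (W.baseChange K) 3 κ 𝔭' ∅ γ).map
        (PowerSeries.map (Summit.BirchSwinnertonDyer.Rank1Residual.X11b.Halves.toUnr 3))).map
        (algebraMap (UnrSeries 3) B))) :
    ((3 : ℕ) : UnrSeries 3) ^ k * L ∈
      (Summit.BirchSwinnertonDyer.Rank1Residual.X11b.AcSelmer.XAc.charIdeal (W.baseChange K) 3 κ 𝔭' ∅ γ).map
        (PowerSeries.map (Summit.BirchSwinnertonDyer.Rank1Residual.X11b.Halves.toUnr 3)) :=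
  mem_of_algebraMap_mem_map r hr _ _ h

end WallInstance

end Summit.BirchSwinnertonDyer.BirchSwinnertonDyer.Cruxes.RationalSplitIMCInclusionAtThree.BaseDoubling
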